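import Mathlib
import Literature.NumberTheory.Sieve.LargestPrimeFactorCubic
import Literature.NumberTheory.Sieve.ShortKloostermanCompletion
import Literature.NumberTheory.Sieve.DivisorBound
import HarnessLib

/-!
# Heath-Brown's `q`-analogue of van der Corput: the case `k = 0` of Theorem 2
# (PLMS 82 (2001), §9 pp. 35–36), from Weil's bound for the complete sums

Topic `Literature/NumberTheory/Sieve`, grouping namespace `ShortKloosterman` (continuation of
`ShortKloostermanCompletion`).  This file PROVES the case `k = 0` of Heath-Brown's Theorem 2
(`Literature.NumberTheory.Sieve.HeathBrown2001_thm2_shortKloosterman`):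
`|Σ_{A<n≤A+B} e_q(w f(n)\overline{g(n)})| ≤ C(D, ε) q^ε {B (∆/q)^{1/2} + (q/∆)^{1/2}}`,
`∆ = (q, w)`, for square-free `q` and `f, g` of degree `≤ D` such that at every prime `p ∣ q`
above a threshold `P₀` there is no linear `h` with `f ≡ g h (mod p)` — GIVEN, as an explicit
hypothesis `hW`, Weil's estimate for the complete sums at the primes `p > P_W` (`P_W ≤ P₀`):
`|completeSum p f g c m| ≤ K √p` for `c ≢ 0`.  The primes `p ≤ P₀` are treated by the trivial
bound `p ≤ √P₀ · √p`, the primes `p ∣ w` by `ShortKloosterman.norm_completeSum_zero_le`; the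
product bound, the g.c.d.-weighted completion and the divisor bound then give the printed
estimate (`levelZero_bound`).  Weil's estimate itself (A. Weil 1948) is the subject of the
`Literature.NumberTheory.LFunctions.RationalExpSum*` files; here it is a hypothesis, stated
verbatim in the form in which it is used, never a named fact.

## References

* D. R. Heath-Brown, *The largest prime factor of `X³ + 2`*, Proc. London Math. Soc. (3) 82
  (2001) 554–596, §9 pp. 35–36 (held text `paper:heathbrown2001-largest-prime-factor-i-x-i-sup`).
  [`HeathBrown2001LargestPrimeFactorCubic`]
-/

noncomputable section

open Finset Polynomial

namespace Literature.NumberTheory.Sieve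

namespace ShortKloosterman

/-! ### §1. Small lemmas -/

section Lemmas

/-- If `g ≡ 0 (mod p)` for a prime `p ∣ q`, the short Kloosterman sum is empty (Heath-Brown
p. 35). [cite: HeathBrown2001LargestPrimeFactorCubic, §9 p. 35] -/
theorem shortKloostermanSum_eq_zero_of_redPoly_eq_zero {q p : ℕ} [NeZero q] (hp : p.Prime)
    (hpq : p ∣ q) {g : ℤ[X]} (hg : redPoly p g = 0) (f : ℤ[X]) (w A : ℤ) (B : ℕ) :
    shortKloostermanSum q f g w A B = 0 := by
  haveI : Fact p.Prime := ⟨hp⟩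
  rw [shortKloostermanSum_eq_sum_periodicPhase]
  refine Finset.sum_eq_zero fun n _ => ?_
  unfold periodicPhase
  rw [if_neg]
  intro hu
  have h1 : ZMod.castHom hpq (ZMod p) ((redPoly q g).eval (n : ZMod q)) = 0 := by
    rw [castHom_eval_redPoly hpq, hg, eval_zero]
  exact not_isUnit_zero (h1 ▸ hu.map (ZMod.castHom hpq (ZMod p)))

/-- `ℓ^{ω(q)} ≤ τ(q)^ℓ` (from `ℓ ≤ 2^ℓ` and `2^{ω(q)} ≤ τ(q)`). [folklore] -/
theorem pow_card_primeFactors_le_card_divisors_pow (ℓ : ℕ) {q : ℕ} (hq : q ≠ 0) :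
    (ℓ : ℝ) ^ q.primeFactors.card ≤ ((q.divisors.card : ℕ) : ℝ) ^ ℓ := by
  have h1 : ℓ ≤ 2 ^ ℓ := Nat.lt_two_pow_self.le
  have h2 : 2 ^ q.primeFactors.card ≤ q.divisors.card := by
    rw [Nat.card_divisors hq, ← Finset.prod_const]
    refine Finset.prod_le_prod' fun p hp => ?_
    have := (Nat.prime_of_mem_primeFactors hp).factorization_pos_of_dvd hq
      (Nat.dvd_of_mem_primeFactors hp)
    omega
  calc (ℓ : ℝ) ^ q.primeFactors.card ≤ ((2 ^ ℓ : ℕ) : ℝ) ^ q.primeFactors.card :=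
        pow_le_pow_left₀ (Nat.cast_nonneg _) (by exact_mod_cast h1) _
    _ = ((2 ^ q.primeFactors.card : ℕ) : ℝ) ^ ℓ := by push_cast; rw [← pow_mul, mul_comm, pow_mul]
    _ ≤ ((q.divisors.card : ℕ) : ℝ) ^ ℓ := pow_le_pow_left₀ (Nat.cast_nonneg _) (by exact_mod_cast h2) _

/-- `1 + log q ≤ (1 + 1/δ) q^δ` for `q ≥ 1`, `δ > 0`. [folklore] -/
theorem one_add_log_le_rpow {q : ℝ} (hq : 1 ≤ q) {δ : ℝ} (hδ : 0 < δ) :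
    1 + Real.log q ≤ (1 + 1 / δ) * q ^ δ := by
  have h1 : 1 ≤ q ^ δ := Real.one_le_rpow hq hδ.le
  have h2 : Real.log q ≤ q ^ δ / δ := Real.log_le_rpow_div (by linarith) hδ
  calc 1 + Real.log q ≤ q ^ δ + q ^ δ / δ := add_le_add h1 h2
    _ = (1 + 1 / δ) * q ^ δ := by ring

/-- The product of distinct primes all dividing `N > 0` is at most `N`. [folklore] -/
theorem prod_primes_le {s : Finset ℕ} {N : ℕ} (hN : 0 < N) (hprime : ∀ p ∈ s, p.Prime)
    (hdvd : ∀ p ∈ s, p ∣ N) : ((∏ p ∈ s, p : ℕ) : ℝ) ≤ N := by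
  have h : ∏ p ∈ s, p ∣ N := Finset.prod_primes_dvd N (fun p hp => (hprime p hp).prime) hdvd
  exact_mod_cast Nat.le_of_dvd hN h

/-- `Π √p = √(Π p)` over a finite set of naturals. [folklore] -/
theorem prod_sqrt_eq (s : Finset ℕ) : ∏ p ∈ s, Real.sqrt p = Real.sqrt (∏ p ∈ s, (p : ℝ)) := by
  rw [Real.sqrt_eq_rpow, ← Real.finsetProd_rpow _ _ (fun p _ => Nat.cast_nonneg p)]
  exact Finset.prod_congr rfl fun p _ => Real.sqrt_eq_rpow _

end Lemmas

/-! ### §2. The square-free bookkeeping `∆ = (q, w)`, `Π_{p ∣ q, p ∤ w} p = q/∆` -/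

section Gcd

/-- For square-free `q > 0` and `∆ = (q, w)`: the primes of `q` dividing `w` multiply to `∆`,
the others to `q / ∆`. [folklore] -/
theorem prod_primeFactors_filter_not_dvd {q : ℕ} (hq : 0 < q) (hsq : Squarefree q) (w : ℤ) :
    ((∏ p ∈ q.primeFactors.filter (fun p : ℕ => ¬ ((p : ℤ) ∣ w)), p : ℕ) : ℝ) =
      (q : ℝ) / (Int.gcd (q : ℤ) w : ℕ) := by
  set Δ : ℕ := Int.gcd (q : ℤ) w with hΔ
  have hΔq : Δ ∣ q := by
    have := Int.gcd_dvd_left (q : ℤ) w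
    exact_mod_cast this
  have hΔ0 : 0 < Δ := Int.gcd_pos_of_ne_zero_left _ (by exact_mod_cast hq.ne')
  have hΔsq : Squarefree Δ := hsq.squarefree_of_dvd hΔq
  -- the primes of `q` dividing `w` are the primes of `∆`
  have hfilter : q.primeFactors.filter (fun p : ℕ => ((p : ℤ) ∣ w)) = Δ.primeFactors := by
    ext p
    rw [Finset.mem_filter, Nat.mem_primeFactors, Nat.mem_primeFactors]
    constructor
    · rintro ⟨⟨hp, hpq, -⟩, hpw⟩
      refine ⟨hp, ?_, hΔ0.ne'⟩
      have : (p : ℤ) ∣ (Δ : ℤ) := by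
        rw [hΔ, Int.gcd_eq_natAbs, Int.natAbs_natCast]
        exact_mod_cast Nat.dvd_gcd hpq (Int.natCast_dvd.mp hpw)
      exact_mod_cast this
    · rintro ⟨hp, hpΔ, -⟩
      refine ⟨⟨hp, hpΔ.trans hΔq, hq.ne'⟩, ?_⟩
      have h1 : (Δ : ℤ) ∣ w := Int.gcd_dvd_right (q : ℤ) w
      exact (Int.natCast_dvd_natCast.mpr hpΔ).trans h1
  have hsplit := Finset.prod_filter_mul_prod_filter_not q.primeFactors (fun p : ℕ => ((p : ℤ) ∣ w))
    (fun p => p)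
  rw [hfilter, Nat.prod_primeFactors_of_squarefree hΔsq, Nat.prod_primeFactors_of_squarefree hsq]
    at hsplit
  have hΔ0' : (Δ : ℝ) ≠ 0 := by exact_mod_cast hΔ0.ne'
  rw [eq_div_iff hΔ0', mul_comm]
  exact_mod_cast hsplit

end Gcd

/-! ### §3. The case `k = 0` -/

section LevelZero

/-- **Heath-Brown's Theorem 2, case `k = 0`** (§9 pp. 35–36), from Weil's estimate as a
hypothesis: let `D, P_W ≤ P₀ ∈ ℕ`, `K ≥ 1`, and suppose (`hW`) that for every prime `p > P_W`,
all `f, g ∈ ℤ[X]` of degree `≤ D` with `g ≢ 0 (mod p)` and no `h ∈ 𝔽_p[X]` of degree `≤ 1`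
with `f ≡ g h`, all `c ≢ 0` and all `m`, `|completeSum p f g c m| ≤ K √p`.  Then for every
`ε > 0` there is `C ≥ 0` such that for all square-free `q > 0`, all `f, g` of degree `≤ D`
such that the non-degeneracy holds at every prime `p ∣ q` with `p > P₀`, and all `w, A, B`,
`|Σ_{A<n≤A+B} e_q(w f(n)\overline{g(n)})| ≤ C q^ε (B √(∆/q) + √(q/∆))`, `∆ = (q, w)`.
[cite: HeathBrown2001LargestPrimeFactorCubic, Thm. 2 (k = 0) and §9 pp. 35–36] -/
theorem levelZero_bound {D P_W P₀ : ℕ} {K : ℝ} (hK : 1 ≤ K) (hPW : P_W ≤ P₀)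
    (hW : ∀ (p : ℕ) [Fact p.Prime], P_W < p → ∀ f g : ℤ[X], f.natDegree ≤ D → g.natDegree ≤ D →
      redPoly p g ≠ 0 →
      (¬ ∃ h : (ZMod p)[X], h.natDegree ≤ 1 ∧ redPoly p f = redPoly p g * h) →
      ∀ c : ZMod p, c ≠ 0 → ∀ m : ZMod p, ‖completeSum p f g c m‖ ≤ K * Real.sqrt p) :
    ∀ ε : ℝ, 0 < ε → ∃ C : ℝ, 0 ≤ C ∧
      ∀ (q : ℕ) (f g : ℤ[X]) (w A : ℤ) (B : ℕ), 0 < q → Squarefree q →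
        f.natDegree ≤ D → g.natDegree ≤ D →
        (∀ p : ℕ, p.Prime → p ∣ q → P₀ < p → ¬ ∃ h : (ZMod p)[X], h.natDegree ≤ 1 ∧
          f.map (Int.castRingHom (ZMod p)) = g.map (Int.castRingHom (ZMod p)) * h) →
        ‖shortKloostermanSum q f g w A B‖ ≤
          C * (q : ℝ) ^ ε * ((B : ℝ) * Real.sqrt ((Int.gcd (q : ℤ) w : ℕ) / (q : ℝ)) +
            Real.sqrt ((q : ℝ) / (Int.gcd (q : ℤ) w : ℕ))) := by
  intro ε hε
  -- the uniform local constant `K₁ = max(K, D, √P₀, 1)` and its integer ceiling `L`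
  set K₁ : ℝ := max (max K D) (Real.sqrt P₀) with hK₁
  have hK₁1 : 1 ≤ K₁ := hK.trans ((le_max_left _ _).trans (le_max_left _ _))
  have hK₁K : K ≤ K₁ := (le_max_left _ _).trans (le_max_left _ _)
  have hK₁D : (D : ℝ) ≤ K₁ := (le_max_right _ _).trans (le_max_left _ _)
  have hK₁P : Real.sqrt P₀ ≤ K₁ := le_max_right _ _
  have hK₁0 : 0 ≤ K₁ := zero_le_one.trans hK₁1
  set L : ℕ := ⌈K₁⌉₊ with hL
  have hL1 : 1 ≤ L := Nat.one_le_ceil_iff.mpr (lt_of_lt_of_le one_pos hK₁1)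
  have hKL : K₁ ≤ L := Nat.le_ceil _
  -- divisor-bound constants
  have hδ : 0 < ε / (3 * L) := by positivity
  have hε3 : 0 < ε / 3 := by positivity
  obtain ⟨C₁, hC₁1, hC₁⟩ := exists_card_divisors_le_mul_rpow hδ
  obtain ⟨C₂, hC₂1, hC₂⟩ := exists_card_divisors_le_mul_rpow hε3
  set C : ℝ := C₁ ^ L * (C₂ * (1 + 1 / (ε / 3))) with hC
  have hC0 : 0 ≤ C := by positivity
  refine ⟨C, hC0, ?_⟩
  intro q f g w A B hq hsq hf hg hnd
  haveI : NeZero q := ⟨hq.ne'⟩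
  have hq1 : (1 : ℝ) ≤ q := by exact_mod_cast hq
  set Δ : ℕ := Int.gcd (q : ℤ) w with hΔdef
  have hΔq : Δ ∣ q := by
    have := Int.gcd_dvd_left (q : ℤ) w
    exact_mod_cast this
  have hΔ0 : 0 < Δ := Int.gcd_pos_of_ne_zero_left _ (by exact_mod_cast hq.ne')
  have hΔ0' : (0 : ℝ) < Δ := by exact_mod_cast hΔ0
  have hq0' : (0 : ℝ) < q := by exact_mod_cast hq
  have hRHS0 : 0 ≤ C * (q : ℝ) ^ ε * ((B : ℝ) * Real.sqrt ((Δ : ℕ) / (q : ℝ)) +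
      Real.sqrt ((q : ℝ) / (Δ : ℕ))) := by positivity
  -- trivial case: `g ≡ 0 (mod p)` for some `p ∣ q`
  by_cases hgp : ∃ p : ℕ, p.Prime ∧ p ∣ q ∧ redPoly p g = 0
  · obtain ⟨p, hp, hpq, hg0⟩ := hgp
    rw [shortKloostermanSum_eq_zero_of_redPoly_eq_zero hp hpq hg0, norm_zero]; exact hRHS0
  simp only [not_exists, not_and] at hgp
  -- local hypotheses at every prime `p ∣ q`
  have hloc : ∀ (p : ℕ) [Fact p.Prime], p ∣ q →
      (∀ m : ZMod p, m ≠ 0 → ‖completeSum p f g 0 m‖ ≤ K₁) ∧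
      (∀ c : ZMod p, c ≠ 0 → ∀ m : ZMod p, ‖completeSum p f g c m‖ ≤ K₁ * Real.sqrt p) := by
    intro p hpF hpq
    have hp := hpF.out
    refine ⟨fun m hm => ?_, fun c hc m => ?_⟩
    · calc ‖completeSum p f g 0 m‖ ≤ g.natDegree := norm_completeSum_zero_le f g (hgp p hp hpq) hm
        _ ≤ D := by exact_mod_cast hg
        _ ≤ K₁ := hK₁D
    · by_cases hpP : P₀ < p
      · -- Weil
        exact (hW p (lt_of_le_of_lt hPW hpP) f g hf hg (hgp p hp hpq) (hnd p hp hpq hpP) c hc m).trans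
          (mul_le_mul_of_nonneg_right hK₁K (Real.sqrt_nonneg _))
      · -- small prime: trivial bound `p = √p √p ≤ √P₀ √p`
        have hpP' : (p : ℝ) ≤ P₀ := by exact_mod_cast not_lt.mp hpP
        calc ‖completeSum p f g c m‖ ≤ p := norm_completeSum_le p f g c m
          _ = Real.sqrt p * Real.sqrt p := (Real.mul_self_sqrt (Nat.cast_nonneg _)).symm
          _ ≤ Real.sqrt P₀ * Real.sqrt p :=
              mul_le_mul_of_nonneg_right (Real.sqrt_le_sqrt hpP') (Real.sqrt_nonneg _)
          _ ≤ K₁ * Real.sqrt p := mul_le_mul_of_nonneg_right hK₁P (Real.sqrt_nonneg _)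
  -- the Fourier coefficients: `|𝓕Φ(b)| ≤ K₁^{ω(q)} √(q/∆) · (∆, b)`
  set M : ℝ := K₁ ^ q.primeFactors.card * Real.sqrt ((q : ℝ) / Δ) with hM
  have hM0 : 0 ≤ M := by positivity
  have hdft : ∀ b : ℕ, b < q → ‖ZMod.dft (periodicPhase q f g w) (b : ZMod q)‖ ≤ M * Nat.gcd Δ b := by
    intro b hb
    rw [dft_periodicPhase]
    set c : ZMod q := (w : ZMod q) with hc
    set m : ZMod q := -(b : ZMod q) with hm
    refine (norm_completeSum_le_prod hK₁1 f g q hsq hloc c m).trans ?_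
    refine (prod_localFactor_le hK₁1 q (fun p => decide (p ∣ c.val)) (fun p => decide (p ∣ m.val))).trans ?_
    rw [hM, mul_assoc]
    refine mul_le_mul_of_nonneg_left ?_ (by positivity)
    -- identify the two prime products
    have hdc : ∀ p ∈ q.primeFactors, (p ∣ c.val ↔ ((p : ℤ) ∣ w)) := by
      intro p hp
      have hpq : p ∣ q := Nat.dvd_of_mem_primeFactors hp
      rw [dvd_val_iff_castHom_eq_zero hpq, hc, map_intCast, ZMod.intCast_zmod_eq_zero_iff_dvd]
    have hdm : ∀ p ∈ q.primeFactors, (p ∣ m.val ↔ p ∣ b) := by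
      intro p hp
      have hpq : p ∣ q := Nat.dvd_of_mem_primeFactors hp
      rw [dvd_val_iff_castHom_eq_zero hpq, hm, map_neg, map_natCast, neg_eq_zero,
        ZMod.natCast_eq_zero_iff]
    -- first product: over primes dividing `∆` and `b`, so at most `(∆, b)`
    have h1 : ((∏ p ∈ q.primeFactors.filter (fun p => decide (p ∣ c.val) && decide (p ∣ m.val)),
        (p : ℝ))) ≤ Nat.gcd Δ b := by
      have hcast : (∏ p ∈ q.primeFactors.filter (fun p => decide (p ∣ c.val) && decide (p ∣ m.val)),
          (p : ℝ)) = ((∏ p ∈ q.primeFactors.filter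
            (fun p => decide (p ∣ c.val) && decide (p ∣ m.val)), p : ℕ) : ℝ) := by push_cast; rfl
      rw [hcast]
      refine prod_primes_le (Nat.gcd_pos_of_pos_left _ hΔ0) (fun p hp => ?_) (fun p hp => ?_)
      · exact Nat.prime_of_mem_primeFactors (Finset.mem_filter.mp hp).1
      · rw [Finset.mem_filter, Bool.and_eq_true, decide_eq_true_eq, decide_eq_true_eq] at hp
        obtain ⟨hpq, hpc, hpm⟩ := hp
        refine Nat.dvd_gcd ?_ ((hdm p hpq).mp hpm)
        have hpw : (p : ℤ) ∣ w := (hdc p hpq).mp hpc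
        have : (p : ℤ) ∣ (Δ : ℤ) := by
          rw [hΔdef, Int.gcd_eq_natAbs, Int.natAbs_natCast]
          exact_mod_cast Nat.dvd_gcd (Nat.dvd_of_mem_primeFactors hpq) (Int.natCast_dvd.mp hpw)
        exact_mod_cast this
    -- second product: over primes of `q` not dividing `w`: `√(q/∆)`
    have h2 : ∏ p ∈ q.primeFactors.filter (fun p => !decide (p ∣ c.val)), Real.sqrt p =
        Real.sqrt ((q : ℝ) / Δ) := by
      have hset : q.primeFactors.filter (fun p => !decide (p ∣ c.val)) =
          q.primeFactors.filter (fun p : ℕ => ¬ ((p : ℤ) ∣ w)) := by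
        refine Finset.filter_congr fun p hp => ?_
        rw [Bool.not_eq_true', decide_eq_false_iff_not, hdc p hp]
      rw [hset, prod_sqrt_eq, ← prod_primeFactors_filter_not_dvd hq hsq w]
      push_cast; rfl
    rw [h2, mul_comm]
    exact mul_le_mul_of_nonneg_left h1 (Real.sqrt_nonneg _)
  -- completion
  have hcompl := norm_sum_Ioc_le_of_dft_le_gcd (periodicPhase q f g w) hΔq hM0 hdft A B
  rw [← shortKloostermanSum_eq_sum_periodicPhase] at hcompl
  -- the three factors `K₁^{ω(q)} ≤ C₁^L q^{ε/3}`, `τ(∆) ≤ C₂ q^{ε/3}`, `1 + log q ≤ (1+3/ε) q^{ε/3}`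
  have hKω : K₁ ^ q.primeFactors.card ≤ C₁ ^ L * (q : ℝ) ^ (ε / 3) := by
    calc K₁ ^ q.primeFactors.card ≤ (L : ℝ) ^ q.primeFactors.card :=
          pow_le_pow_left₀ hK₁0 hKL _
      _ ≤ ((q.divisors.card : ℕ) : ℝ) ^ L := pow_card_primeFactors_le_card_divisors_pow L hq.ne'
      _ ≤ (C₁ * (q : ℝ) ^ (ε / (3 * L))) ^ L :=
          pow_le_pow_left₀ (Nat.cast_nonneg _) (hC₁ q hq.ne') L
      _ = C₁ ^ L * (q : ℝ) ^ (ε / 3) := by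
          rw [mul_pow, ← Real.rpow_natCast ((q : ℝ) ^ _), ← Real.rpow_mul hq0'.le]
          congr 2
          have hL0 : (L : ℝ) ≠ 0 := by exact_mod_cast (by omega : L ≠ 0)
          field_simp
  have hτ : ((Δ.divisors.card : ℕ) : ℝ) ≤ C₂ * (q : ℝ) ^ (ε / 3) := by
    calc ((Δ.divisors.card : ℕ) : ℝ) ≤ ((q.divisors.card : ℕ) : ℝ) := by
          exact_mod_cast Finset.card_le_card (Nat.divisors_subset_of_dvd hq.ne' hΔq)
      _ ≤ C₂ * (q : ℝ) ^ (ε / 3) := hC₂ q hq.ne'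
  have hlog : 1 + Real.log q ≤ (1 + 1 / (ε / 3)) * (q : ℝ) ^ (ε / 3) := one_add_log_le_rpow hq1 hε3
  -- assemble
  have hq3 : ((q : ℝ) ^ (ε / 3)) ^ 3 = (q : ℝ) ^ ε := by
    rw [← Real.rpow_natCast, ← Real.rpow_mul hq0'.le]; norm_num
  have hQ1 : (1 : ℝ) ≤ (q : ℝ) ^ (ε / 3) := Real.one_le_rpow hq1 hε3.le
  have hsqrt_id : Real.sqrt ((q : ℝ) / Δ) * ((Δ : ℝ) * B / q) = (B : ℝ) * Real.sqrt ((Δ : ℝ) / q) := by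
    have e1 : Real.sqrt ((q : ℝ) / Δ) * ((Δ : ℝ) / q) = Real.sqrt ((Δ : ℝ) / q) := by
      have key : ∀ s t : ℝ, 0 < s → 0 < t → s / t * (t * t / (s * s)) = t / s := by
        intro s t hs ht; field_simp
      have := key (Real.sqrt q) (Real.sqrt Δ) (Real.sqrt_pos.mpr hq0') (Real.sqrt_pos.mpr hΔ0')
      rw [Real.mul_self_sqrt hq0'.le, Real.mul_self_sqrt hΔ0'.le] at this
      rw [Real.sqrt_div' _ hΔ0'.le, Real.sqrt_div' _ hq0'.le]
      exact this
    calc Real.sqrt ((q : ℝ) / Δ) * ((Δ : ℝ) * B / q) = B * (Real.sqrt ((q : ℝ) / Δ) * ((Δ : ℝ) / q)) := by ring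
      _ = (B : ℝ) * Real.sqrt ((Δ : ℝ) / q) := by rw [e1]
  calc ‖shortKloostermanSum q f g w A B‖
      ≤ M * ((Δ : ℝ) * B / q + ((Δ.divisors.card : ℕ) : ℝ) * (1 + Real.log q)) := hcompl
    _ = K₁ ^ q.primeFactors.card * ((B : ℝ) * Real.sqrt ((Δ : ℝ) / q) +
          ((Δ.divisors.card : ℕ) : ℝ) * (1 + Real.log q) * Real.sqrt ((q : ℝ) / Δ)) := by
        rw [hM, mul_assoc, mul_add, hsqrt_id]; ring
    _ ≤ (C₁ ^ L * (q : ℝ) ^ (ε / 3)) * ((B : ℝ) * Real.sqrt ((Δ : ℝ) / q) +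
          (C₂ * (q : ℝ) ^ (ε / 3)) * ((1 + 1 / (ε / 3)) * (q : ℝ) ^ (ε / 3)) *
            Real.sqrt ((q : ℝ) / Δ)) := by
        have hlog0 : 0 ≤ 1 + Real.log q := by
          have := Real.log_nonneg hq1; linarith
        gcongr
    _ ≤ C * (q : ℝ) ^ ε * ((B : ℝ) * Real.sqrt ((Δ : ℝ) / q) + Real.sqrt ((q : ℝ) / Δ)) := by
        -- `q^{ε/3} X + q^{ε/3}·q^{2ε/3} Y ≤ q^ε (X + Y)` and constants
        rw [hC, ← hq3]
        have hX : 0 ≤ (B : ℝ) * Real.sqrt ((Δ : ℝ) / q) := by positivity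
        have hY : 0 ≤ Real.sqrt ((q : ℝ) / Δ) := Real.sqrt_nonneg _
        have hc3 : (1 : ℝ) ≤ C₂ * (1 + 1 / (ε / 3)) := by
          have : (1 : ℝ) ≤ 1 + 1 / (ε / 3) := by
            have : 0 ≤ 1 / (ε / 3) := by positivity
            linarith
          nlinarith
        set Q := (q : ℝ) ^ (ε / 3) with hQ
        have hQ0 : 0 ≤ Q := zero_le_one.trans hQ1
        have hC₁L : (1 : ℝ) ≤ C₁ ^ L := one_le_pow₀ hC₁1
        -- termwise
        have t1 : C₁ ^ L * Q * ((B : ℝ) * Real.sqrt ((Δ : ℝ) / q)) ≤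
            C₁ ^ L * (C₂ * (1 + 1 / (ε / 3))) * Q ^ 3 * ((B : ℝ) * Real.sqrt ((Δ : ℝ) / q)) := by
          have : C₁ ^ L * Q ≤ C₁ ^ L * (C₂ * (1 + 1 / (ε / 3))) * Q ^ 3 := by
            have hQ3 : Q ≤ Q ^ 3 := by
              calc Q = Q * 1 * 1 := by ring
                _ ≤ Q * Q * Q := by gcongr
                _ = Q ^ 3 := by ring
            calc C₁ ^ L * Q = C₁ ^ L * 1 * Q := by ring
              _ ≤ C₁ ^ L * (C₂ * (1 + 1 / (ε / 3))) * Q ^ 3 := by gcongr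
          exact mul_le_mul_of_nonneg_right this hX
        have t2 : C₁ ^ L * Q * (C₂ * Q * ((1 + 1 / (ε / 3)) * Q) * Real.sqrt ((q : ℝ) / Δ)) =
            C₁ ^ L * (C₂ * (1 + 1 / (ε / 3))) * Q ^ 3 * Real.sqrt ((q : ℝ) / Δ) := by ring
        rw [mul_add, mul_add, t2]
        exact add_le_add t1 le_rfl

end LevelZero

end ShortKloosterman

end Literature.NumberTheory.Sieve
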